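/-
Copyright (c) 2026 the pub-hodgecm-mathlib formalisation cell (harness21).  Prover seat hodgecm-mathlib-LH4-p13 (g0): Track A «(D-RAM) FOUR-FRAME» squad of crux H413
(dealer LH4-plan (g10) WORD #29 «p13 → (e) `stub_U2H_typeTwoRow_wild`»; LH4-p05 (g0) CENSUS v2 (f) «type dichotomy»), 2026-09-03.
-/
import Literature.NumberTheory.Automorphic.UnitaryTwoRamifiedFixedSelfDualVerticesUnitType       -- ★ p855177 (this seat): brings (W2)-Place (`forall_coe_mem_glInt_iff_sym2_rhoVertexActPlace_eq`), the tree action, ★ B-p14 transport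
import HarnessLib

/-!
# The number of SELF-DUAL cosets fixed by an element of `U(Φ₂)` at a ramified place of `√π`-TYPE (anti-fixed UNIFORMISER) is a count of set-wise fixed EDGES of the
# tree of `SL₂(L⁺_v)`: `#Fix_{γ₂}(U₂ ⧸ K₂) = #{e | g·e = e}` — ANY such place, no `|2|_w = 1` (Tits 1979 §2.7, §3.2; Serre, *Trees* I §6.1, II §1.3; Kottwitz 1988 §2)

Topic `NumberTheory/Automorphic`; namespace `Literature.NumberTheory.Automorphic.UnitaryGroup` (as ★ p847070, ★ p855177, ★ p855231).  THEOREMS ONLY (no definition, no instance,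
no notation, no named fact, no `sorry`); kernel lane `--supports stmt-HodgeConjecture-24833`.  Cell `pub/hodgecm-mathlib` (D-0151), crux H413; Track A «(D-RAM) FOUR-FRAME»,
unit U2H (ii-H), child (e) `stub_U2H_typeTwoRow_wild` (dealer LH4-plan (g10) WORD #29; LH4-p06 (g0) ED. 6 (ρ)∕(e₀)); the groundwork under ★ p855119
`F0P3cDyRamHProfilesTypeTwoUnfolding` (`Φ^st(γ_H, hFamily 0) = ν_H(K₂ × U₁) · #Fix_{γ₂}(U₂ ⧸ K₂)` at ANY ramified place).  At a √π-TYPE place (`d = v_w(𝔇)` odd: every tame place,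
and the WILD places of type `L⁺_v(√π)`) the self-dual level `K₂ = U(Φ₂)(𝒪_v)` is the set-wise stabiliser of the reference EDGE (★ (W2)-Place `forall_coe_mem_glInt_iff_sym2_rhoVertexActPlace_eq`,
base dart `(v₁, v₀)`), so its fixed-coset count is a set-wise fixed-EDGE count — the companion of ★ p847070 §1 (`K♯` ↔ vertices at √π-type) WITHOUT the tame guard, and the
√π-twin of ★ p855231 (there √u-type, `K♯` ↔ edges).  HONEST LABEL: HC_CM is proved only modulo the 7 printed citations (2 remaining named inputs: hLiu418 = stmt-HodgeConjecture-24832,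
h413 = stmt-HodgeConjecture-24833) until rung 0 closes; transport along ★ theorems only; the census of the fixed edge set is NOT here.

* §1 `ncard_fixedBy_quotient_comap_glInt_eq_ncard_fixedEdges_of_v_eq_exp_neg_one` — one-place model, √π-type: the `GL₂(𝒪_w)`-coset count is the set-wise fixed-edge count
  (★ B-p14 `ncard_fixedBy_quotient_eq_of_edgeAction` over ★ `latticeTree_adj_rhoVertexActPlace_iff`, ★ `latticeTree_adj_root` (symmetrised), ★ `exists_rhoVertexActPlace_eq_of_adj'`
  (one dart orbit, base dart `(v₁, v₀)`), ★ (W2)-Place; then ★ `rhoVertexActPlace_eq_glVertexAct`).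
* §2 **`natCard_fixedBy_cmLocalIntegralLevel_eq_ncard_fixedEdges_of_v_eq_exp_neg_one`** — THE HEAD on `U₂ = U(Φ₂)(L⁺_v)`: `#Fix_{γ₂}(U₂ ⧸ K₂) = #{e | g·e = e}` at a √π-type
  ramified place (★ p855177 §2 transport `natCard_fixedBy_cmLocalIntegralLevel_eq_ncard_fixedBy_onePlace`, then §1).

## References
* [Tits1979] J. Tits, *Reductive groups over local fields*, PSPM 33.1 (1979), §2.7 p. 48, §3.2 p. 50.
* [Serre1980Trees] J.-P. Serre, *Trees* (1980), Ch. I §6.1, Ch. II §1.1–§1.3.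
* [Kottwitz1988] R. E. Kottwitz, *Tamagawa numbers*, Ann. of Math. 127 (1988), §2.
* [Kottwitz1986BaseChangeUnits] R. E. Kottwitz, *Base change for unit elements of Hecke algebras*, Compositio Math. 60 (1986), §1 pp. 240–241.
-/

set_option autoImplicit false

noncomputable section

open scoped WithZero ValuativeRel Matrix MatrixGroups
open Matrix WithZero ValuativeRel NumberField IsDedekindDomain MulAction

namespace Literature.NumberTheory.Automorphic.UnitaryGroup

open Literature.NumberTheory.Automorphic Literature.NumberTheory.Automorphic.HermitianLatticeTree Literature.GroupTheory

section Place

variable (L : Type) [Field L] [NumberField L] [IsCMField L] (v : HeightOneSpectrum (𝓞 ↥(maximalRealSubfield L)))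
  (w : PlacesOver L v) (hw : IsCMField.complexConj L • w.1 = w.1)
  {α : w.1.adicCompletion L} (hα : galAdicCompletionMap (L := L) (IsCMField.complexConj L) hw α = -α) (hα0 : α ≠ 0)
  {ϖF : v.adicCompletion ↥(maximalRealSubfield L)} (hϖF : Valued.v ϖF = exp (-1 : ℤ))

/-! ## §1 The `GL₂(𝒪_w)`-coset count as a set-wise fixed-edge count at a √π-type place -/

include hα hα0 in
/-- **THE `K₂`-COSET COUNT IS A SET-WISE FIXED-EDGE COUNT AT A √π-TYPE RAMIFIED PLACE** (`α` an anti-fixed UNIFORMISER, `|α| = exp(−1)`; tame OR wild): for EVERY `u ∈ U_w` and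
any descent representative `(s, g)` (`diag(1,α) u diag(1,α)⁻¹ = s · ι_w(g)`), `#Fix_u(U_w ⧸ (U_w ∩ GL₂(𝒪_w))) = #{e ∈ E(X) | (g · ) e = e}` — `X` the tree of `SL₂(L⁺_v)`, edges fixed
SET-WISE, `Set.ncard` on both sides.  Edge transport ★ B-p14 `ncard_fixedBy_quotient_eq_of_edgeAction` with base dart `(v₁, v₀)` over ★ `latticeTree_adj_rhoVertexActPlace_iff`,
★ `latticeTree_adj_root`, ★ `exists_rhoVertexActPlace_eq_of_adj'` and the √π edge head ★ (W2)-Place `forall_coe_mem_glInt_iff_sym2_rhoVertexActPlace_eq`; then ★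
`rhoVertexActPlace_eq_glVertexAct`.  No `|2|_w = 1`. [cite: Serre1980Trees, Ch. I §6.1; Ch. II §1.3] [cite: Tits1979, §3.2 p. 50] [cite: Kottwitz1988, §2] [cite: Kottwitz1986BaseChangeUnits, §1 pp. 240–241] -/
theorem ncard_fixedBy_quotient_comap_glInt_eq_ncard_fixedEdges_of_v_eq_exp_neg_one (he : v.asIdeal.ramificationIdx' w.1.asIdeal ≠ 1)
    (hvα : Valued.v α = exp (-1 : ℤ))
    (u : ↥(unitaryGroupOfForm (galAdicCompletionMap (L := L) (IsCMField.complexConj L) hw)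
      (placeForm (Matrix.of fun i j : Fin 2 => if i.val + j.val + 1 = 2 then (1 : L) else 0) w.1)))
    {s : w.1.adicCompletion L} {g : GL (Fin 2) (v.adicCompletion ↥(maximalRealSubfield L))} (hs : s ≠ 0)
    (hsg : Matrix.diagonal ![1, α] * ((u : GL (Fin 2) (w.1.adicCompletion L)) : Matrix (Fin 2) (Fin 2) (w.1.adicCompletion L)) * Matrix.diagonal ![1, α⁻¹] =
      s • (g : Matrix (Fin 2) (Fin 2) (v.adicCompletion ↥(maximalRealSubfield L))).map (toPlace v w)) :
    (fixedBy (↥(unitaryGroupOfForm (galAdicCompletionMap (L := L) (IsCMField.complexConj L) hw)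
        (placeForm (Matrix.of fun i j : Fin 2 => if i.val + j.val + 1 = 2 then (1 : L) else 0) w.1)) ⧸
        ((glInt 2 (w.1.adicCompletion L)).comap
          (unitaryGroupOfForm (galAdicCompletionMap (L := L) (IsCMField.complexConj L) hw)
            (placeForm (Matrix.of fun i j : Fin 2 => if i.val + j.val + 1 = 2 then (1 : L) else 0) w.1)).subtype)) u).ncard =
      {e : (latticeTree (RingHom.id (v.adicCompletion ↥(maximalRealSubfield L))) ϖF !![(0 : v.adicCompletion ↥(maximalRealSubfield L)), 1; -1, 0]).edgeSet |
          Sym2.map (glVertexAct (isUniformizingElement_of_v_eq hϖF) g)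
            (e : Sym2 {M : Submodule 𝒪[v.adicCompletion ↥(maximalRealSubfield L)] (Fin 2 → v.adicCompletion ↥(maximalRealSubfield L)) //
              IsSpecialLattice (RingHom.id _) ϖF !![(0 : v.adicCompletion ↥(maximalRealSubfield L)), 1; -1, 0] M}) = e}.ncard := by
  haveI : IsDiscreteValuationRing 𝒪[v.adicCompletion ↥(maximalRealSubfield L)] := isDiscreteValuationRing_integer_of_compatible hϖF
  have h0 : ϖF ≠ 0 := (isUniformizingElement_of_v_eq hϖF).ne_zero
  -- the reference dart `(v₁, v₀)` = `(latt diag(1, ϖ_F), latt 1)`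
  have hsd : IsSpecialLattice (RingHom.id _) ϖF !![(0 : v.adicCompletion ↥(maximalRealSubfield L)), 1; -1, 0]
      (latt (1 : Matrix (Fin 2) (Fin 2) (v.adicCompletion ↥(maximalRealSubfield L)))) :=
    Or.inl ((isSelfDualLattice_id_altJ_iff _).2 ⟨1, by rw [Units.val_one], by rw [Units.val_one, det_one, map_one]⟩)
  have hdet1 : (Matrix.diagonal ![(1 : v.adicCompletion ↥(maximalRealSubfield L)), ϖF]).det ≠ 0 := by
    rw [Matrix.det_diagonal, Fin.prod_univ_two]; simpa using h0
  have hmod : IsSpecialLattice (RingHom.id _) ϖF !![(0 : v.adicCompletion ↥(maximalRealSubfield L)), 1; -1, 0]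
      (latt (Matrix.diagonal ![(1 : v.adicCompletion ↥(maximalRealSubfield L)), ϖF])) := by
    refine Or.inr ((isModularLattice_id_altJ_iff h0 _).2 ⟨Matrix.GeneralLinearGroup.mk'' _ (isUnit_iff_ne_zero.2 hdet1), rfl, ?_⟩)
    show valuation _ (Matrix.diagonal ![(1 : v.adicCompletion ↥(maximalRealSubfield L)), ϖF]).det = valuation _ ϖF
    rw [Matrix.det_diagonal, Fin.prod_univ_two]; simp
  set v₀ : {M : Submodule 𝒪[v.adicCompletion ↥(maximalRealSubfield L)] (Fin 2 → v.adicCompletion ↥(maximalRealSubfield L)) //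
      IsSpecialLattice (RingHom.id _) ϖF !![(0 : v.adicCompletion ↥(maximalRealSubfield L)), 1; -1, 0] M} := ⟨_, hsd⟩ with hv₀def
  set v₁ : {M : Submodule 𝒪[v.adicCompletion ↥(maximalRealSubfield L)] (Fin 2 → v.adicCompletion ↥(maximalRealSubfield L)) //
      IsSpecialLattice (RingHom.id _) ϖF !![(0 : v.adicCompletion ↥(maximalRealSubfield L)), 1; -1, 0] M} := ⟨_, hmod⟩ with hv₁def
  have hv₀ : v₀.1 = latt (1 : Matrix (Fin 2) (Fin 2) (v.adicCompletion ↥(maximalRealSubfield L))) := rfl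
  have hv₁ : v₁.1 = latt (Matrix.diagonal ![(1 : v.adicCompletion ↥(maximalRealSubfield L)), ϖF]) := rfl
  have h10 : (latticeTree (RingHom.id (v.adicCompletion ↥(maximalRealSubfield L))) ϖF !![(0 : v.adicCompletion ↥(maximalRealSubfield L)), 1; -1, 0]).Adj v₁ v₀ :=
    (latticeTree_adj_root (isUniformizingElement_of_v_eq hϖF) v₀ v₁ hv₀ hv₁).symm
  -- automorphisms, one dart orbit (base dart `(v₁, v₀)`), the set-wise edge stabiliser (√π-type)
  have hadj := latticeTree_adj_rhoVertexActPlace_iff L v w hw hα hα0 hϖF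
  have hD : ∀ a b : {M : Submodule 𝒪[v.adicCompletion ↥(maximalRealSubfield L)] (Fin 2 → v.adicCompletion ↥(maximalRealSubfield L)) //
      IsSpecialLattice (RingHom.id _) ϖF !![(0 : v.adicCompletion ↥(maximalRealSubfield L)), 1; -1, 0] M},
      (latticeTree (RingHom.id (v.adicCompletion ↥(maximalRealSubfield L))) ϖF !![(0 : v.adicCompletion ↥(maximalRealSubfield L)), 1; -1, 0]).Adj a b →
      ∃ u' : ↥(unitaryGroupOfForm (galAdicCompletionMap (L := L) (IsCMField.complexConj L) hw)
        (placeForm (Matrix.of fun i j : Fin 2 => if i.val + j.val + 1 = 2 then (1 : L) else 0) w.1)),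
        rhoVertexActPlace L v w hw hα hα0 hϖF u' v₁ = a ∧ rhoVertexActPlace L v w hw hα hα0 hϖF u' v₀ = b :=
    fun a b hab => exists_rhoVertexActPlace_eq_of_adj' L v w hw hα hα0 hϖF he v₁ v₀ hv₁ hv₀ hab
  have hKe := forall_coe_mem_glInt_iff_sym2_rhoVertexActPlace_eq L v w hw hα hα0 hϖF v₀ v₁ hv₀ hv₁ he hvα
  have hcount := ncard_fixedBy_quotient_eq_of_edgeAction (rhoVertexActPlace L v w hw hα hα0 hϖF) (rhoVertexActPlace_one L v w hw hα hα0 hϖF)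
    (rhoVertexActPlace_mul L v w hw hα hα0 hϖF) hadj h10 hD
    ((glInt 2 (w.1.adicCompletion L)).comap
      (unitaryGroupOfForm (galAdicCompletionMap (L := L) (IsCMField.complexConj L) hw)
        (placeForm (Matrix.of fun i j : Fin 2 => if i.val + j.val + 1 = 2 then (1 : L) else 0) w.1)).subtype)
    (fun g' => by rw [Subgroup.mem_comap, Subgroup.coe_subtype]; exact hKe g') u
  -- `ρ_w(u) = (g · )`
  have hρ : rhoVertexActPlace L v w hw hα hα0 hϖF u = glVertexAct (isUniformizingElement_of_v_eq hϖF) g :=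
    funext fun M => rhoVertexActPlace_eq_glVertexAct L v w hw hα hα0 hϖF u hs hsg M
  rw [hρ] at hcount
  exact hcount

/-! ## §2 The head on the CM carrier `U₂ = U(Φ₂)(L⁺_v)` -/

include hα hα0 in
/-- **THE SELF-DUAL FIXED-COSET COUNT AT A √π-TYPE RAMIFIED PLACE IS A SET-WISE FIXED-EDGE COUNT**: `w ∣ v` ramified non-split, `α ∈ L_w` an anti-fixed UNIFORMISER (`σ_w α = −α`,
`|α| = exp(−1)` — every tame place and the wild places of type `L⁺_v(√π)`, `d` odd), `ϖ_F` a uniformiser of `L⁺_v`; for `γ₂ ∈ U₂` and any descent representative `(s, g)` of `E₂ γ₂`: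
**`#Fix_{γ₂}(U₂ ⧸ K₂) = #{e ∈ E(X) | (g · ) e = e}`**, `K₂ = U(Φ₂)(𝒪_v)` (★ p855177 §2 transport, then §1).  With ★ p855119: `Φ^st(γ_H, hFamily 0) = ν_H(K₂ × U₁) · #{set-wise fixed edges of g}`
on the type-(2) population at a √π-type place (★ p847070 §1 gives the `K♯` VERTEX column there), no `|2|_w = 1`. [cite: Tits1979, §2.7 p. 48, §3.2 p. 50]
[cite: Serre1980Trees, Ch. I §6.1; Ch. II §1.3] [cite: Kottwitz1988, §2] [cite: Kottwitz1986BaseChangeUnits, §1 pp. 240–241] -/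
theorem natCard_fixedBy_cmLocalIntegralLevel_eq_ncard_fixedEdges_of_v_eq_exp_neg_one (he : v.asIdeal.ramificationIdx' w.1.asIdeal ≠ 1)
    (hvα : Valued.v α = exp (-1 : ℤ))
    (γ₂ : ((cmDatum L 2 (Matrix.of fun i j : Fin 2 => if i.val + j.val + 1 = 2 then (1 : L) else 0)).Local v))
    {s : w.1.adicCompletion L} {g : GL (Fin 2) (v.adicCompletion ↥(maximalRealSubfield L))} (hs : s ≠ 0)
    (hsg : Matrix.diagonal ![1, α] * ((((localNonsplitEquiv (IsCMField.complexConj L) (Matrix.of fun i j : Fin 2 => if i.val + j.val + 1 = 2 then (1 : L) else 0) (IsCMField.complexConj_ne_one L) w hw) γ₂ : ↥(unitaryGroupOfForm (galAdicCompletionMap (L := L) (IsCMField.complexConj L) hw) (placeForm (Matrix.of fun i j : Fin 2 => if i.val + j.val + 1 = 2 then (1 : L) else 0) w.1))) : GL (Fin 2) (w.1.adicCompletion L)) : Matrix (Fin 2) (Fin 2) (w.1.adicCompletion L)) * Matrix.diagonal ![1, α⁻¹] =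
      s • (g : Matrix (Fin 2) (Fin 2) (v.adicCompletion ↥(maximalRealSubfield L))).map (toPlace v w)) :
    Nat.card (fixedBy (((cmDatum L 2 (Matrix.of fun i j : Fin 2 => if i.val + j.val + 1 = 2 then (1 : L) else 0)).Local v) ⧸
        cmLocalIntegralLevel L 2 (Matrix.of fun i j : Fin 2 => if i.val + j.val + 1 = 2 then (1 : L) else 0) v) γ₂) =
      {e : (latticeTree (RingHom.id (v.adicCompletion ↥(maximalRealSubfield L))) ϖF !![(0 : v.adicCompletion ↥(maximalRealSubfield L)), 1; -1, 0]).edgeSet |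
          Sym2.map (glVertexAct (isUniformizingElement_of_v_eq hϖF) g)
            (e : Sym2 {M : Submodule 𝒪[v.adicCompletion ↥(maximalRealSubfield L)] (Fin 2 → v.adicCompletion ↥(maximalRealSubfield L)) //
              IsSpecialLattice (RingHom.id _) ϖF !![(0 : v.adicCompletion ↥(maximalRealSubfield L)), 1; -1, 0] M}) = e}.ncard := by
  rw [natCard_fixedBy_cmLocalIntegralLevel_eq_ncard_fixedBy_onePlace L v w hw γ₂]
  exact ncard_fixedBy_quotient_comap_glInt_eq_ncard_fixedEdges_of_v_eq_exp_neg_one L v w hw hα hα0 hϖF he hvα _ hs hsg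

end Place

end Literature.NumberTheory.Automorphic.UnitaryGroup

end
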